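import Mathlib.Geometry.Manifold.PartitionOfUnity
import Mathlib.Topology.MetricSpace.Thickening
import Literature.Analysis.FunctionSpaces.ContDiffHolderPrecomposition
import HarnessLib

/-!
# Localization tools for `C^{k,r}_b`: cutoffs, smooth maps on open sets (Hölder spaces, part 10)

Topic `Literature/Analysis/FunctionSpaces`. Chart transitions and chart representatives of
geometric quantities are smooth only on OPEN subsets of the model space, while the classes
`C^{k,r}_b(E, F)` (parts 1, 3) and the composition lemmas (parts 6, 7) are global. This file
bridges the two in the standard way — multiply by smooth cutoffs with compact support inside the
open set:

* `MemContDiffHolder.of_contDiff_of_hasCompactSupport` — `C^∞` maps with compact support are in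
  every `C^{k,r}_b`, `r ≤ 1`;
* `exists_contDiff_one_nhdsSet_of_isCompact` — on a finite-dimensional space, for `K` compact
  inside `U` open there is a `C^∞` cutoff `χ : E → [0,1]` with compact support in `U` and `χ = 1`
  near `K` (Mathlib's `exists_contMDiffMap_one_nhds_of_subset_interior` on a compact thickening);
* `ContDiff.smul_of_contDiffOn` (in this namespace) — `χ • T` is globally `C^∞` when `T` is `C^∞` on an open set
  containing the support of the global cutoff `χ`;
* `MemContDiffHolder.smul_comp_of_contDiffOn` — **localized pre-composition**: for
  `u ∈ C^{k,r}_b(E, F)`, `T` smooth on an open `U ⊆ E'` and a cutoff `χ` with compact support in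
  `U`, `y ↦ χ y • u (T y)` is in `C^{k,r}_b(E', F)` (parts 5 and 7 applied to a compactly
  supported smooth modification of `T`);
* `MemContDiffHolder.smul_of_contDiffOn` — a smooth coefficient `a` on an open `U` times a member
  `v` with compact support inside `U` is a member.

These are the two moves used to pass between a function on a compact manifold and its chart
representatives (Gilbarg–Trudinger 2001, §6.2, proof of Lemma 6.5; Joyce 2007, §1.2), bricks of
item (1d) of the census of `Literature.Geometry.Riemannian.gurskyViaclovsky_pathOpen_weighted_four`.
Everything is proved; no named facts. Spaces are taken in universe `0` where products with real
cutoffs are formed (the tree's Leibniz estimate is one-universe; `ℝ : Type`).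

## References

* D. Gilbarg, N. S. Trudinger, *Elliptic Partial Differential Equations of Second Order* (2001),
  §4.1, §6.2. [GilbargTrudinger2001]
-/

noncomputable section

open Set Filter Metric Topology
open scoped NNReal Manifold ContDiff

namespace Literature.Analysis.FunctionSpaces

/-! ### Smooth compactly supported maps are members -/

section CompactSupport

variable {E F : Type*} [NormedAddCommGroup E] [NormedSpace ℝ E] [NormedAddCommGroup F]
  [NormedSpace ℝ F] {k : ℕ} {r : ℝ≥0}

/-- The derivatives of a `C^∞` map with compact support are bounded. [folklore] -/
theorem eSupNorm_iteratedFDeriv_lt_top_of_hasCompactSupport {f : E → F} (hf : ContDiff ℝ ∞ f)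
    (hs : HasCompactSupport f) (j : ℕ) : eSupNorm (iteratedFDeriv ℝ j f) < ⊤ := by
  have hcont : Continuous (iteratedFDeriv ℝ j f) :=
    hf.continuous_iteratedFDeriv (by exact_mod_cast le_top)
  obtain ⟨C, hC⟩ := hcont.bounded_above_of_compact_support (hs.iteratedFDeriv j)
  exact eSupNorm_lt_top_iff.2 ⟨C, hC⟩

/-- **`C^∞` maps with compact support are in `C^{k,r}_b`** for every `k` and `r ≤ 1` (all
derivatives bounded; the `k`-th is bounded and Lipschitz, hence `r`-Hölder). [folklore] -/
theorem MemContDiffHolder.of_contDiff_of_hasCompactSupport {f : E → F} (hf : ContDiff ℝ ∞ f)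
    (hs : HasCompactSupport f) (hr : r ≤ 1) : MemContDiffHolder k r f := by
  refine ⟨hf.of_le (by exact_mod_cast le_top),
    fun j _ => eSupNorm_iteratedFDeriv_lt_top_of_hasCompactSupport hf hs j, ?_⟩
  exact (holderWith_iteratedFDeriv_of_eSupNorm_ne_top (hf.of_le (by exact_mod_cast le_top))
    (eSupNorm_iteratedFDeriv_lt_top_of_hasCompactSupport hf hs (k + 1)).ne
    (eSupNorm_iteratedFDeriv_lt_top_of_hasCompactSupport hf hs k).ne hr).memHolder

end CompactSupport

/-! ### Cutoffs -/

section Cutoff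

variable {E : Type*} [NormedAddCommGroup E] [NormedSpace ℝ E] [FiniteDimensional ℝ E]

/-- **Smooth cutoffs**: for `K` compact inside `U` open in a finite-dimensional real normed space
there is `χ ∈ C^∞(E, [0,1])` with compact support contained in `U` and `χ = 1` on a neighbourhood
of `K`. [folklore] -/
theorem exists_contDiff_one_nhdsSet_of_isCompact {K U : Set E} (hK : IsCompact K) (hU : IsOpen U)
    (hKU : K ⊆ U) :
    ∃ χ : E → ℝ, ContDiff ℝ ∞ χ ∧ HasCompactSupport χ ∧ tsupport χ ⊆ U ∧
      (∀ᶠ y in 𝓝ˢ K, χ y = 1) ∧ ∀ y, χ y ∈ Icc (0 : ℝ) 1 := by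
  obtain ⟨δ, hδ, hδU⟩ := hK.exists_cthickening_subset_open hU hKU
  have ht : IsCompact (cthickening δ K) := hK.cthickening
  have hKint : K ⊆ interior (cthickening δ K) :=
    (self_subset_thickening hδ K).trans (thickening_subset_interior_cthickening δ K)
  obtain ⟨f, hf1, hf0, hf01⟩ :=
    exists_contMDiffMap_one_nhds_of_subset_interior 𝓘(ℝ, E) hK.isClosed hKint (n := ⊤)
  have hsupp : tsupport f ⊆ cthickening δ K := by
    refine closure_minimal (fun y hy => ?_) isClosed_cthickening
    by_contra h
    exact hy (hf0 y h)
  refine ⟨f, ?_, ?_, hsupp.trans hδU, hf1, hf01⟩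
  · exact contMDiff_iff_contDiff.1 f.contMDiff
  · exact ht.of_isClosed_subset (isClosed_tsupport _) hsupp

end Cutoff

/-! ### Smooth maps on open sets times cutoffs -/

section SmulOpen

variable {E G : Type*} [NormedAddCommGroup E] [NormedSpace ℝ E] [NormedAddCommGroup G]
  [NormedSpace ℝ G]

/-- **`χ • T` is globally `C^∞`** when `χ ∈ C^∞(E)` has support inside an open set `U` on which
`T` is `C^∞` (outside `U` the product vanishes near every point). [folklore] -/
theorem ContDiff.smul_of_contDiffOn {χ : E → ℝ} (hχ : ContDiff ℝ ∞ χ) {T : E → G} {U : Set E}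
    (hU : IsOpen U) (hT : ContDiffOn ℝ ∞ T U) (hχU : tsupport χ ⊆ U) :
    ContDiff ℝ ∞ fun y => χ y • T y := by
  rw [contDiff_iff_contDiffAt]
  intro y
  by_cases hy : y ∈ U
  · exact hχ.contDiffAt.smul (hT.contDiffAt (hU.mem_nhds hy))
  · have hy' : y ∉ tsupport χ := fun h => hy (hχU h)
    have hev : (fun y => χ y • T y) =ᶠ[𝓝 y] fun _ => (0 : G) := by
      filter_upwards [notMem_tsupport_iff_eventuallyEq.1 hy'] with z hz
      simp [hz]
    exact (contDiffAt_const (c := (0 : G))).congr_of_eventuallyEq hev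

end SmulOpen

/-! ### Localized pre-composition and smooth coefficients -/

section Localized

variable {E E' F : Type} [NormedAddCommGroup E] [NormedSpace ℝ E] [NormedAddCommGroup E']
  [NormedSpace ℝ E'] [FiniteDimensional ℝ E'] [NormedAddCommGroup F] [NormedSpace ℝ F]
  {k : ℕ} {r : ℝ≥0}

/-- **Localized pre-composition**: for `u ∈ C^{k,r}_b(E, F)`, `T : E' → E` of class `C^∞` on an
open set `U` and a `C^∞` cutoff `χ` with compact support inside `U`,
`y ↦ χ y • u (T y) ∈ C^{k,r}_b(E', F)` (`r ≤ 1`). Proof: modify `T` to `χ̂ • T` with a second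
cutoff `χ̂ = 1` near `tsupport χ` — a global `C^∞` map with compact support, hence with bounded
derivatives — and apply parts 7 (pre-composition) and 5 (product with `χ`). [cite: GilbargTrudinger2001, §6.2] -/
theorem MemContDiffHolder.smul_comp_of_contDiffOn (hr : r ≤ 1) {u : E → F}
    (hu : MemContDiffHolder k r u) {T : E' → E} {U : Set E'} (hU : IsOpen U)
    (hT : ContDiffOn ℝ ∞ T U) {χ : E' → ℝ} (hχ : ContDiff ℝ ∞ χ) (hχs : HasCompactSupport χ)
    (hχU : tsupport χ ⊆ U) : MemContDiffHolder k r fun y => χ y • u (T y) := by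
  -- second cutoff and the modified change of variables
  obtain ⟨ψ, hψ, hψs, hψU, hψ1, -⟩ := exists_contDiff_one_nhdsSet_of_isCompact hχs hU hχU
  set T' : E' → E := fun y => ψ y • T y with hT'
  have hT'smooth : ContDiff ℝ ∞ T' := ContDiff.smul_of_contDiffOn hψ hU hT hψU
  have hT'supp : HasCompactSupport T' := hψs.smul_right
  have hT'2 : ContDiff ℝ (k + 2 : ℕ) T' := hT'smooth.of_le (WithTop.coe_le_coe.mpr le_top)
  have hDT' : MemContDiffHolder k r (_root_.fderiv ℝ T') :=
    memContDiffHolder_fderiv_of_bounds hr hT'2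
      fun j _ _ => eSupNorm_iteratedFDeriv_lt_top_of_hasCompactSupport hT'smooth hT'supp j
  -- `u ∘ T'` and `χ` are members, hence so is the product
  have hT'1 : ContDiff ℝ (k + 1 : ℕ) T' := hT'smooth.of_le (WithTop.coe_le_coe.mpr le_top)
  have hcomp : MemContDiffHolder k r (u ∘ T') := hu.comp_right hr hT'1 hDT'
  have hχmem : MemContDiffHolder k r χ :=
    MemContDiffHolder.of_contDiff_of_hasCompactSupport hχ hχs hr
  have hprod : MemContDiffHolder k r fun y =>
      ContinuousLinearMap.lsmul ℝ ℝ (χ y) ((u ∘ T') y) :=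
    hχmem.bilinear hr (ContinuousLinearMap.lsmul ℝ ℝ) hcomp
  -- the product is the function in question
  have heq : (fun y => χ y • u (T y)) = fun y =>
      ContinuousLinearMap.lsmul ℝ ℝ (χ y) ((u ∘ T') y) := by
    funext y
    rw [ContinuousLinearMap.lsmul_apply, Function.comp_apply]
    by_cases hy : χ y = 0
    · simp [hy]
    · have hyK : y ∈ tsupport χ := subset_closure (Function.mem_support.2 hy)
      have h1 : ψ y = 1 := hψ1.self_of_nhdsSet y hyK
      simp [hT', h1]
  rw [heq]
  exact hprod

/-- **Smooth coefficients**: a coefficient `a : E' → ℝ` of class `C^∞` on an open set `U` times a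
member `v ∈ C^{k,r}_b(E', F)` with compact support inside `U` is a member (`r ≤ 1`). [folklore] -/
theorem MemContDiffHolder.smul_of_contDiffOn (hr : r ≤ 1) {v : E' → F} (hv : MemContDiffHolder k r v)
    (hvs : HasCompactSupport v) {a : E' → ℝ} {U : Set E'} (hU : IsOpen U) (ha : ContDiffOn ℝ ∞ a U)
    (hvU : tsupport v ⊆ U) : MemContDiffHolder k r fun y => a y • v y := by
  obtain ⟨ψ, hψ, hψs, hψU, hψ1, -⟩ := exists_contDiff_one_nhdsSet_of_isCompact hvs hU hvU
  set a' : E' → ℝ := fun y => ψ y • a y with ha'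
  have ha'smooth : ContDiff ℝ ∞ a' := ContDiff.smul_of_contDiffOn hψ hU ha hψU
  have ha'supp : HasCompactSupport a' := hψs.smul_right
  have ha'mem : MemContDiffHolder k r a' :=
    MemContDiffHolder.of_contDiff_of_hasCompactSupport ha'smooth ha'supp hr
  have hprod : MemContDiffHolder k r fun y => ContinuousLinearMap.lsmul ℝ ℝ (a' y) (v y) :=
    ha'mem.bilinear hr (ContinuousLinearMap.lsmul ℝ ℝ) hv
  have heq : (fun y => a y • v y) = fun y => ContinuousLinearMap.lsmul ℝ ℝ (a' y) (v y) := by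
    funext y
    rw [ContinuousLinearMap.lsmul_apply]
    by_cases hy : v y = 0
    · simp [hy]
    · have hyK : y ∈ tsupport v := subset_closure (Function.mem_support.2 hy)
      have h1 : ψ y = 1 := hψ1.self_of_nhdsSet y hyK
      simp [ha', h1]
  rw [heq]
  exact hprod

/-- **Smooth vector coefficients read through a member**: for `v ∈ C^{k,r}_b(E', ℝ)` with compact
support inside an open `U` and `w : E' → F` of class `C^∞` on `U`, `y ↦ v y • w y` is a member. [folklore] -/
theorem MemContDiffHolder.smul_right_of_contDiffOn (hr : r ≤ 1) {v : E' → ℝ}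
    (hv : MemContDiffHolder k r v) (hvs : HasCompactSupport v) {w : E' → F} {U : Set E'}
    (hU : IsOpen U) (hw : ContDiffOn ℝ ∞ w U) (hvU : tsupport v ⊆ U) :
    MemContDiffHolder k r fun y => v y • w y := by
  obtain ⟨ψ, hψ, hψs, hψU, hψ1, -⟩ := exists_contDiff_one_nhdsSet_of_isCompact hvs hU hvU
  set w' : E' → F := fun y => ψ y • w y with hw'
  have hw'smooth : ContDiff ℝ ∞ w' := ContDiff.smul_of_contDiffOn hψ hU hw hψU
  have hw'supp : HasCompactSupport w' := hψs.smul_right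
  have hw'mem : MemContDiffHolder k r w' :=
    MemContDiffHolder.of_contDiff_of_hasCompactSupport hw'smooth hw'supp hr
  have hprod : MemContDiffHolder k r fun y => ContinuousLinearMap.lsmul ℝ ℝ (v y) (w' y) :=
    hv.bilinear hr (ContinuousLinearMap.lsmul ℝ ℝ) hw'mem
  have heq : (fun y => v y • w y) = fun y => ContinuousLinearMap.lsmul ℝ ℝ (v y) (w' y) := by
    funext y
    rw [ContinuousLinearMap.lsmul_apply]
    by_cases hy : v y = 0
    · simp [hy]
    · have hyK : y ∈ tsupport v := subset_closure (Function.mem_support.2 hy)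
      have h1 : ψ y = 1 := hψ1.self_of_nhdsSet y hyK
      simp [hw', h1]
  rw [heq]
  exact hprod

end Localized

end Literature.Analysis.FunctionSpaces

end
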